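import Summits.ABC.IUTFork.Conditional.AbcOfSHvolRefutation
import HarnessLib

/-!
# Branch C, TARGET #1 — NO PRINT-SHAPED CONSTANT REPAIRS THE (U) COMPUTABLE HALF: for EVERY `a, c ≥ 0` the binder
# «`Cor22.HullVolumeAtDatum P l ((l+1)/4·((1 + a·d_mod/l)·(log-diff + log-cond) + c·(2 log l + 52 + (20/3)·log(d*l)·π(d*l))))` at every
# admissible `(λ, l)`» is FALSE AS TYPED (print's `B_III` is `a = 12`, `c = 1`) — abc-iut cell, R2 S-chain team, seat abc-iut-s2-p2 gen 2
# («U-LINE-NO-REPAIR»); crux ThetaPartII = stmt-ABC-19678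

Record-only PROOF file (D-0012) of the abc-iut cell; TAKES NO SIDE on [IUTchIII] Cor. 3.12, on [IUTchIV] Thm. 1.10 or on any author.
S. Mochizuki, *IUT IV* [Mochizuki2012], Thm. 1.10 proof Steps (ii), (v), (viii) pp. 24, 27–30; Cor. 2.2 (ii) proof (P1)–(P7) pp. 44–46.
[claim: Mochizuki2012, status: disputed] for every IUT quotation; the content of THIS file is classical real arithmetic plus compositions of landed
cell theorems — abc-iut-s2-p5 gen 2's refutation `Conditional.not_hvol_v3` (`AbcOfSHvolRefutation`, p453135) with the numerals of print's `B_III`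
replaced by PARAMETERS.

WHY (the one referee objection the refutation of `hvol` leaves open: «is it an artifact of the explicit constants 12, 52, 20/3, d* of [IUTchIV]
Thm. 1.10?»). abc-iut-s2-p1 gen 2's necessity `PointDict.pointMixedShare_le_sub_gain_of_hullVolumeAtDatum` (p446116) holds for an ARBITRARY bound `δ`:
`Cor22.HullVolumeAtDatum P l δ` at a point with `4·d_mod ≤ l+5` forces «mixed-height sum ≤ δ − ((l+5)/4 − d_mod)·(lD + (1 − 1/l)·lC)». For a bound of
print's SHAPE `δ_{a,c}(P,l) = ((l+1)/4)·((1 + a·d_mod/l)(lD + lC) + c·E(P,l))`, `E = 2 log l + 52 + (20/3)·log(d*l)·π(d*l)`, the right side at a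
`d_mod = 2` point is `≤ (1+a)·lD + (a + 5/4)·h + ((l+1)/4)·c·E`, i.e. `O_a(h) + O_c(l²)` in print's (P1) window, while at abc-iut-s2-p5's family
`P_k = (ℚ(√2), 1/2 + 2/(3+√2)^k)` the mixed-height sum at `W = {7}` is `≥ (l+1)·k·log 7/48`, of order `h^{3/2}` — so the SAME admissible data
violate the necessity for every `a, c ≥ 0` once `k ≥ k₀(a, c)` (`k₀` from abc-iut-s2-p5's growth lemma `exists_sqrt_log_lt_linear`, never evaluated).

* `shape_violation_real` — the real-arithmetic endgame with parameters `a, c` (abc-iut-s2-p5's `sharp_violation_real` is `a`-coefficient `8`, `c = 1`);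
* `exists_quadWitness_shapeSlack_lt` — for every `a, c ≥ 0` and every height `H`, admissible `(P_k, l)` in the window with
  `δ_{a,c}(P_k,l) − ((l+5)/4 − d_mod)·(lD + (1−1/l)·lC) <` the mixed-height sum at `W = {7}` (abc-iut-s2-p5's `exists_quadWitness_sharpSlack_lt` VERBATIM
  up to the slack shape: window prime by abc-iut-s2-p3's `Cor22Window.exists_admissible_prime_window`, (P2)/(P5)/(P6) PROVED there);
* **`not_hullVolume_printShape`** — for every `a, c ≥ 0` the (U) computable half with the bound `δ_{a,c}` is FALSE AS TYPED at admissible data.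

READING (numbers; statements about the cell's typed objects). The (Ind1) slot residue of the typed multiradial region ((Ind1) = all capsule-index
permutations, plan/c312/STEPV-IND1-NOTE.md) at a deep mixed prime is proportional to `(l+1)·(depth)`, and no bound that is linear in
`log-diff + log-cond` with an `l`-independent coefficient plus an `O(l²)` additive term absorbs it along a family of fixed Szpiro ratio and
unbounded depth read at print's window prime `l ≍ h^{1/2}`. Hence on the (U) reading the repair of record is NOT a change of constants but the
Szpiro-bad cut `hregBad` (plan C-R28 (3)(α) / C-R32; this seat's tail p452755) — or the (P) reading, where the computable half is a theorem
(abc-iut-S7/S3, p425589). Nothing here is a statement about [IUTchIII] Cor. 3.12 or about print; no side taken on any author; typed ≠ proved.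
PROOF-ONLY file: no definitions, no named `Prop` facts. [cite: Mochizuki2012, IUTchIV Thm. 1.10 proof Step (v) p. 27–28, Step (viii) p. 30]
[cite: Mochizuki2012, IUTchIV Cor. 2.2 (ii) proof (P1)–(P7) p. 44–46] [cite: DupuyHilado2025, §3.3, §3.6, §4.7, §4.12]
-/

noncomputable section

namespace Summit.ABC.IUTFork

open NumberField IsDedekindDomain Literature.IUT.LogVolume Literature.IUT.HodgeTheaters
open Literature.NumberTheory.DiophantineGeometry.GenEll Literature.NumberTheory.NumberFields
open scoped Classical

namespace Conditional

open PointDict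

/-- A prime `l ≥ 7` different from `7` is `≥ 11`. [folklore] -/
private theorem eleven_le_of_prime' {l : ℕ} (hl : l.Prime) (h7 : 7 ≤ l) (hne : l ≠ 7) : 11 ≤ l := by
  rcases Nat.lt_or_ge l 11 with hlt | hge
  · interval_cases l
    · exact absurd rfl hne
    · exact absurd hl (by norm_num)
    · exact absurd hl (by norm_num)
    · exact absurd hl (by norm_num)
  · exact hge

/-- **The real-arithmetic endgame with PARAMETRIC constants.** With `d = 2`, `l ≥ 11`, `a, c ≥ 0`, `0 ≤ lD`, `0 ≤ lC ≤ h`,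
`h^{1/2} ≤ l ≤ 10δ·h^{1/2}·log(2δh)`, `h ≤ A + B·k` (`B > 0`), `k·log 7 ≤ S`, `1/2 ≤ ω`, `E ≤ 34·δ·l + 52` and the growth inequality
`(1+a)·lD + 13c + A·log 7/(48B) + (a + 5/4)·h^{1/2} + 85c·δ²·h^{1/2}·log(2δh) < (log 7/(48B))·h`:
`((l+1)/4)·((1 + a·d/l)(lD + lC) + c·E) − ((l+5)/4 − d)·(lD + (1−1/l)·lC) < (1/(2l))·S·(l(l+1)/12 − 4(1−ω)/((l−1)ω³))`
(abc-iut-s2-p5's `sharp_violation_real` is the case of print's numerals). [folklore] -/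
theorem shape_violation_real {k l d lD lC h A B δ S ω E a c : ℝ} (hd : d = 2) (hl : 11 ≤ l) (hδ : 0 < δ)
    (ha : 0 ≤ a) (hc : 0 ≤ c)
    (hlD : 0 ≤ lD) (hlC0 : 0 ≤ lC) (hlC : lC ≤ h) (hh : 0 < h) (hlo : Real.sqrt h ≤ l)
    (hhi : l ≤ 10 * δ * Real.sqrt h * Real.log (2 * δ * h)) (hAB : h ≤ A + B * k) (hB : 0 < B)
    (hS : k * Real.log 7 ≤ S) (hk : 0 ≤ k) (hω : 1 / 2 ≤ ω) (hE : E ≤ 34 * δ * l + 52)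
    (hgrowth : (1 + a) * lD + 13 * c + A * (Real.log 7 / (48 * B)) + (a + 5 / 4) * Real.sqrt h
        + 85 * c * δ ^ 2 * Real.sqrt h * Real.log (2 * δ * h) < Real.log 7 / (48 * B) * h) :
    (l + 1) / 4 * ((1 + a * d / l) * (lD + lC) + c * E) - ((l + 5) / 4 - d) * (lD + (1 - 1 / l) * lC) <
      1 / (2 * l) * S * (l * (l + 1) / 12 - 4 * (1 - ω) / ((l - 1) * ω ^ 3)) := by
  subst hd
  have hl0 : 0 < l := by linarith
  have hl1 : 1 ≤ l + 1 := by linarith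
  have hlog7 : 0 < Real.log 7 := Real.log_pos (by norm_num)
  have hkS : 0 ≤ k * Real.log 7 := mul_nonneg hk hlog7.le
  have hS0 : 0 ≤ S := hkS.trans hS
  set s : ℝ := Real.sqrt h with hs_def
  set L : ℝ := Real.log (2 * δ * h) with hL_def
  have hsq0 : 0 ≤ s := Real.sqrt_nonneg h
  have hsqpos : 0 < s := Real.sqrt_pos.mpr hh
  -- the (Ind1)-tail: `4(1−ω)/((l−1)ω³) ≤ 16/(l−1) ≤ l(l+1)/24`
  have hω3 : 1 / 8 ≤ ω ^ 3 := by
    have e : (ω - 1 / 2) * (ω ^ 2 + ω / 2 + 1 / 4) = ω ^ 3 - 1 / 8 := by ring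
    have : 0 ≤ (ω - 1 / 2) * (ω ^ 2 + ω / 2 + 1 / 4) := mul_nonneg (by linarith) (by positivity)
    linarith
  have hω0 : 0 < ω ^ 3 := by linarith
  have htail : 4 * (1 - ω) / ((l - 1) * ω ^ 3) ≤ 16 / (l - 1) := by
    rw [div_le_div_iff₀ (mul_pos (by linarith) hω0) (by linarith)]
    have h1 : 4 * (1 - ω) * (l - 1) ≤ 2 * (l - 1) :=
      mul_le_mul_of_nonneg_right (by linarith) (by linarith)
    have h2 : (l - 1) * (1 / 8) ≤ (l - 1) * ω ^ 3 := mul_le_mul_of_nonneg_left hω3 (by linarith)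
    linarith
  have h16 : 16 / (l - 1) ≤ l * (l + 1) / 24 := by
    rw [div_le_div_iff₀ (by linarith) (by norm_num)]
    have h1 : (11 : ℝ) * 12 ≤ l * (l + 1) := mul_le_mul hl (by linarith) (by norm_num) (by linarith)
    have h2 : (11 : ℝ) * 12 * 10 ≤ l * (l + 1) * (l - 1) :=
      mul_le_mul h1 (by linarith) (by norm_num) (by positivity)
    linarith
  have hf : l * (l + 1) / 24 ≤ l * (l + 1) / 12 - 4 * (1 - ω) / ((l - 1) * ω ^ 3) := by linarith
  have hf0 : 0 ≤ l * (l + 1) / 24 := by positivity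
  -- lower bound of the mixed side: `(l+1)·k·log 7/48`
  have hmix : k * Real.log 7 * (l + 1) / 48 ≤
      1 / (2 * l) * S * (l * (l + 1) / 12 - 4 * (1 - ω) / ((l - 1) * ω ^ 3)) := by
    have h1 : k * Real.log 7 * (l * (l + 1) / 24) ≤ S * (l * (l + 1) / 12 - 4 * (1 - ω) / ((l - 1) * ω ^ 3)) :=
      mul_le_mul hS hf hf0 hS0
    have e : k * Real.log 7 * (l + 1) / 48 = 1 / (2 * l) * (k * Real.log 7 * (l * (l + 1) / 24)) := by
      field_simp
      ring
    rw [e, mul_assoc (1 / (2 * l))]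
    exact mul_le_mul_of_nonneg_left h1 (by positivity)
  -- upper bound of the slack side: coefficients of `lD`, `lC`, `E`
  have hrat : (l + 1) / (2 * l) ≤ 1 := by
    rw [div_le_one (by positivity)]; linarith
  have haco : a * ((l + 1) / (2 * l)) ≤ a := by
    have := mul_le_mul_of_nonneg_left hrat ha
    simpa using this
  have hcD : (l + 1) / 4 * (1 + a * 2 / l) - ((l + 5) / 4 - 2) = 1 + a * ((l + 1) / (2 * l)) := by
    field_simp
    ring
  have hcC : (l + 1) / 4 * (1 + a * 2 / l) - ((l + 5) / 4 - 2) * (1 - 1 / l)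
      = (5 * l - 3) / (4 * l) + a * ((l + 1) / (2 * l)) := by
    field_simp
    ring
  have h53 : (5 * l - 3) / (4 * l) ≤ 5 / 4 := by
    rw [div_le_div_iff₀ (by positivity) (by norm_num)]
    linarith
  have hcoefD : (l + 1) / 4 * (1 + a * 2 / l) - ((l + 5) / 4 - 2) ≤ 1 + a := by
    rw [hcD]; linarith
  have hcoefC : (l + 1) / 4 * (1 + a * 2 / l) - ((l + 5) / 4 - 2) * (1 - 1 / l) ≤ a + 5 / 4 := by
    rw [hcC]; linarith
  have hexp : (l + 1) / 4 * ((1 + a * 2 / l) * (lD + lC) + c * E) - ((l + 5) / 4 - 2) * (lD + (1 - 1 / l) * lC)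
      = ((l + 1) / 4 * (1 + a * 2 / l) - ((l + 5) / 4 - 2)) * lD
        + ((l + 1) / 4 * (1 + a * 2 / l) - ((l + 5) / 4 - 2) * (1 - 1 / l)) * lC
        + (l + 1) / 4 * c * E := by ring
  have hstepD : ((l + 1) / 4 * (1 + a * 2 / l) - ((l + 5) / 4 - 2)) * lD ≤ (1 + a) * lD :=
    mul_le_mul_of_nonneg_right hcoefD hlD
  have hstepC : ((l + 1) / 4 * (1 + a * 2 / l) - ((l + 5) / 4 - 2) * (1 - 1 / l)) * lC ≤ (a + 5 / 4) * lC :=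
    mul_le_mul_of_nonneg_right hcoefC hlC0
  have hstepE : (l + 1) / 4 * c * E ≤ (l + 1) / 4 * c * (34 * δ * l + 52) :=
    mul_le_mul_of_nonneg_left hE (by positivity)
  have ha54 : 0 ≤ a + 5 / 4 := by linarith
  have hstepC' : (a + 5 / 4) * lC ≤ (a + 5 / 4) * h := mul_le_mul_of_nonneg_left hlC ha54
  have hstep1 : (l + 1) / 4 * ((1 + a * 2 / l) * (lD + lC) + c * E) - ((l + 5) / 4 - 2) * (lD + (1 - 1 / l) * lC) ≤
      (1 + a) * lD + (a + 5 / 4) * h + (l + 1) / 4 * c * (34 * δ * l + 52) := by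
    rw [hexp]; linarith
  -- `L = log(2δh) ≥ 0` (else `l ≤ 10δ·s·L < 0`)
  have hL0 : 0 ≤ L := by
    by_contra hneg
    have hneg' : L < 0 := lt_of_not_ge hneg
    have : 10 * δ * s * L < 0 := mul_neg_of_pos_of_neg (by positivity) hneg'
    linarith
  -- every slack term against a multiple of `l + 1`
  have ha1 : 0 ≤ 1 + a := by linarith
  have hA1 : (1 + a) * lD ≤ (1 + a) * (lD * (l + 1)) :=
    mul_le_mul_of_nonneg_left (le_mul_of_one_le_right hlD hl1) ha1
  have hhs : h = s * s := (Real.mul_self_sqrt hh.le).symm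
  have hss : s * s ≤ s * (l + 1) := mul_le_mul_of_nonneg_left (by linarith) hsq0
  have hA2 : (a + 5 / 4) * h ≤ (a + 5 / 4) * (s * (l + 1)) := by
    apply mul_le_mul_of_nonneg_left _ ha54
    linarith
  have hA3 : δ * l * (l + 1) ≤ δ * (10 * δ * s * L) * (l + 1) :=
    mul_le_mul_of_nonneg_right (mul_le_mul_of_nonneg_left hhi hδ.le) (by linarith)
  have hA3c : c * (δ * l * (l + 1)) ≤ c * (δ * (10 * δ * s * L) * (l + 1)) := mul_le_mul_of_nonneg_left hA3 hc
  have e4 : (l + 1) / 4 * c * (34 * δ * l + 52) = 17 / 2 * (c * (δ * l * (l + 1))) + 13 * c * (l + 1) := by ring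
  have e5 : c * (δ * (10 * δ * s * L) * (l + 1)) = 10 * (c * δ ^ 2 * s * L * (l + 1)) := by ring
  -- the growth inequality gives `(1+a)lD + 13c + (a+5/4)s + 85cδ²sL < k·log 7/48`
  have hkey : (1 + a) * lD + 13 * c + (a + 5 / 4) * s + 85 * c * δ ^ 2 * s * L < k * Real.log 7 / 48 := by
    have hκ : 0 < Real.log 7 / (48 * B) := by positivity
    have h1 : Real.log 7 / (48 * B) * h ≤ Real.log 7 / (48 * B) * (A + B * k) :=
      mul_le_mul_of_nonneg_left hAB hκ.le
    have e : Real.log 7 / (48 * B) * (A + B * k) = A * (Real.log 7 / (48 * B)) + k * Real.log 7 / 48 := by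
      field_simp
    linarith
  have hkey' := mul_lt_mul_of_pos_right hkey (by linarith : (0 : ℝ) < l + 1)
  have e7 : ((1 + a) * lD + 13 * c + (a + 5 / 4) * s + 85 * c * δ ^ 2 * s * L) * (l + 1) =
      (1 + a) * (lD * (l + 1)) + 13 * c * (l + 1) + (a + 5 / 4) * (s * (l + 1)) + 85 * (c * δ ^ 2 * s * L * (l + 1)) := by ring
  have e8 : k * Real.log 7 / 48 * (l + 1) = k * Real.log 7 * (l + 1) / 48 := by ring
  linarith

/-- **ABOVE EVERY HEIGHT, THE ADMISSIBLE DEGREE-2 FAMILY VIOLATES THE NECESSITY INEQUALITY FOR EVERY PRINT-SHAPED BOUND.** For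
`a, c ≥ 0`, abc-iut-s2-p5's family `P_k = (ℚ(√2), λ_k)`, `λ_k = 1/2 + 2/(3+√2)^k`, with its places `𝔭 ∋ 3+√2`, `𝔭' ∋ 3−√2` over `7`, and every `H`:
there are `k ≥ 6` and a prime `l ≥ 7`, `l ≠ 7`, with (P2), (P5), (P6) at `(P_k, l)` PROVED (abc-iut-s2-p3's window prime), `4·d_mod(P_k) ≤ l + 5`,
`H < log(q^∀(λ_k))`, positive good weight over `7`, and
`δ_{a,c}(P_k,l) − ((l+5)/4 − d_mod)·(log-diff + (1 − 1/l)·log-cond) <` the mixed-height sum at `W = {7}`,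
`δ_{a,c} = ((l+1)/4)·((1 + a·d_mod/l)(log-diff + log-cond) + c·(2 log l + 52 + (20/3)·log(d*l)·π(d*l)))`.
abc-iut-s2-p5's `exists_quadWitness_sharpSlack_lt` VERBATIM except for the slack shape. Nothing asserted about print or any author.
[cite: Mochizuki2012, IUTchIV Cor. 2.2 (ii) proof (P1)–(P7) p. 44–46] [cite: Mochizuki2012, IUTchIV Thm. 1.10 Step (v) p. 27–28]
[claim: Mochizuki2012, status: disputed] -/
theorem exists_quadWitness_shapeSlack_lt (a c : ℝ) (ha : 0 ≤ a) (hc : 0 ≤ c) {𝔭 𝔭' : HeightOneSpectrum (𝓞 QuadWitness.F)}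
    (ha𝔭 : QuadWitness.a ∈ 𝔭.asIdeal) (habar : QuadWitness.abar ∈ 𝔭'.asIdeal) (ha' : QuadWitness.a ∉ 𝔭'.asIdeal)
    (h7 : ((7 : ℕ) : 𝓞 QuadWitness.F) ∈ 𝔭.asIdeal) (h7' : ((7 : ℕ) : 𝓞 QuadWitness.F) ∈ 𝔭'.asIdeal) (H : ℝ) :
    ∃ k : ℕ, 6 ≤ k ∧ ∃ l : ℕ, l.Prime ∧ 7 ≤ l ∧ l ≠ 7 ∧
      Cor22.CondP2 (QuadWitness.P k) l ∧ Cor22.CondP5 (QuadWitness.P k) l ∧ Cor22.CondP6 (QuadWitness.P k) l ∧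
      4 * (Cor22.dmod (QuadWitness.P k) : ℝ) ≤ (l : ℝ) + 5 ∧
      H < Cor22.logQForall (QuadWitness.P k) ∧
      (∀ p ∈ ({7} : Finset ℕ), 0 < ∑ V ∈ Finset.univ.filter
          (fun V : placesOver ↥(IntermediateField.adjoin ℚ ({Cor22.jInv (QuadWitness.P k).x} : Set (QuadWitness.P k).F)) p =>
            ¬ (ord _ V.1 (Cor22.jMod (QuadWitness.P k)) < 0 ∧ ((2 : ℕ) : 𝓞 _) ∉ V.1.asIdeal ∧ ((l : ℕ) : 𝓞 _) ∉ V.1.asIdeal)),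
          weight _ V.1) ∧
      ((l : ℝ) + 1) / 4 *
            ((1 + a * (Cor22.dmod (QuadWitness.P k) : ℝ) / l) * ((QuadWitness.P k).logDiff + Cor22.logCondAvoid (QuadWitness.P k) {2, l})
              + c * (2 * Real.log l + 52
                + 20 / 3 * Real.log (((2 ^ 12 * 3 ^ 3 * 5 * Cor22.dmod (QuadWitness.P k) : ℕ) : ℝ) * (l : ℝ))
                  * (Nat.primeCounting (2 ^ 12 * 3 ^ 3 * 5 * Cor22.dmod (QuadWitness.P k) * l) : ℝ)))
          - (((l : ℝ) + 5) / 4 - Cor22.dmod (QuadWitness.P k))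
            * ((QuadWitness.P k).logDiff + (1 - 1 / (l : ℝ)) * Cor22.logCondAvoid (QuadWitness.P k) {2, l}) <
        ∑ p ∈ ({7} : Finset ℕ), (1 / (2 * (l : ℝ)) *
          ∑ V : placesOver ↥(IntermediateField.adjoin ℚ ({Cor22.jInv (QuadWitness.P k).x} : Set (QuadWitness.P k).F)) p,
            (if ord _ V.1 (Cor22.jMod (QuadWitness.P k)) < 0 ∧ ((2 : ℕ) : 𝓞 _) ∉ V.1.asIdeal ∧ ((l : ℕ) : 𝓞 _) ∉ V.1.asIdeal then
              weight _ V.1 * (((-ord _ V.1 (Cor22.jMod (QuadWitness.P k)) : ℤ) : ℝ) * logNorm _ V.1 / (localDegree _ V.1 : ℝ))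
             else 0)) *
          ((l : ℝ) * ((l : ℝ) + 1) / 12
            - 4 * (1 - ∑ V ∈ Finset.univ.filter
                  (fun V : placesOver ↥(IntermediateField.adjoin ℚ ({Cor22.jInv (QuadWitness.P k).x} : Set (QuadWitness.P k).F)) p =>
                    ¬ (ord _ V.1 (Cor22.jMod (QuadWitness.P k)) < 0 ∧ ((2 : ℕ) : 𝓞 _) ∉ V.1.asIdeal ∧
                      ((l : ℕ) : 𝓞 _) ∉ V.1.asIdeal)),
                  weight _ V.1) /
              (((l : ℝ) - 1) * (∑ V ∈ Finset.univ.filter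
                  (fun V : placesOver ↥(IntermediateField.adjoin ℚ ({Cor22.jInv (QuadWitness.P k).x} : Set (QuadWitness.P k).F)) p =>
                    ¬ (ord _ V.1 (Cor22.jMod (QuadWitness.P k)) < 0 ∧ ((2 : ℕ) : 𝓞 _) ∉ V.1.asIdeal ∧
                      ((l : ℕ) : 𝓞 _) ∉ V.1.asIdeal)),
                  weight _ V.1) ^ 3)) := by
  haveI h7p : Fact (Nat.Prime 7) := ⟨by norm_num⟩
  obtain ⟨H₀, hH₀⟩ := Cor22Window.exists_admissible_prime_window (CBData.std {2} QuadWitness.hS2) 2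
  obtain ⟨A, B, hA0, hB0, hAB⟩ := logQForall_quadWitness_le
  have hlog2 : 0 < Real.log 2 := Real.log_pos (by norm_num)
  -- the two places over `7` as elements of `V(F)_7`
  let v₀ : placesOver QuadWitness.F 7 := ⟨𝔭, Cor22.mem_placesOver_of_natCast_mem 7 𝔭 h7⟩
  let w : placesOver QuadWitness.F 7 := ⟨𝔭', Cor22.mem_placesOver_of_natCast_mem 7 𝔭' h7'⟩
  have hvw : w ≠ v₀ := by
    intro h
    have : 𝔭' = 𝔭 := congrArg Subtype.val h
    exact ha' (this ▸ ha𝔭)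
  obtain ⟨hn1, -⟩ := SplitDepth.localDegree_eq_one QuadWitness.finrank_F v₀ w hvw
  obtain ⟨hwt1, hlog7⟩ := SplitDepth.weight_eq_half_and_logNorm_eq QuadWitness.finrank_F v₀ w hvw
  obtain ⟨hwt2, -⟩ := SplitDepth.weight_eq_half_and_logNorm_eq QuadWitness.finrank_F w v₀ (Ne.symm hvw)
  have h2𝔭 : ((2 : ℕ) : 𝓞 QuadWitness.F) ∉ v₀.1.asIdeal :=
    SplitDepth.natCast_not_mem_of_prime_ne v₀ Nat.prime_two (by norm_num)
  -- the log-different of the family does not depend on `k` (it is the log-different of `ℚ(√2)`)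
  have hlD : ∀ k, (QuadWitness.P k).logDiff = (QuadWitness.P 0).logDiff := fun _ => rfl
  have hδ : (0 : ℝ) < Cor22.delta 2 := by norm_num [Cor22.delta]
  -- the height of `P_k` is at least `k·log 2`
  have hlogQ : ∀ {k : ℕ}, 1 ≤ k → (k : ℝ) * Real.log 2 ≤ Cor22.logQForall (QuadWitness.P k) := fun {k} hk1 =>
    (QuadWitness.le_logQAvoid_P ha𝔭 h7 hk1 Nat.prime_three (by norm_num)).trans
      (Cor22.logQAvoid_anti (QuadWitness.P k) (Finset.empty_subset _))
  -- case `B = 0`: the height would be bounded — absurd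
  rcases hB0.eq_or_lt with hB | hB
  · exfalso
    have h1 := hlogQ (k := ⌈A / Real.log 2⌉₊ + 1) (by omega)
    have h2 := hAB (⌈A / Real.log 2⌉₊ + 1)
    rw [← hB, zero_mul, add_zero] at h2
    have h3 : A / Real.log 2 ≤ ⌈A / Real.log 2⌉₊ := Nat.le_ceil _
    rw [div_le_iff₀ hlog2] at h3
    have h4 : (((⌈A / Real.log 2⌉₊ + 1 : ℕ) : ℝ)) * Real.log 2 = (⌈A / Real.log 2⌉₊ : ℝ) * Real.log 2 + Real.log 2 := by
      push_cast; ring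
    linarith
  -- case `B > 0`: the growth lemma
  obtain ⟨H₁, -, hH₁⟩ := exists_sqrt_log_lt_linear ((1 + a) * (QuadWitness.P 0).logDiff + 13 * c + A * (Real.log 7 / (48 * B)))
    (a + 5 / 4) (85 * c * Cor22.delta 2 ^ 2) (2 * Cor22.delta 2) (Real.log 7 / (48 * B)) (by positivity) (by positivity)
    (by have := Real.log_pos (by norm_num : (1 : ℝ) < 7); positivity)
  -- choose `k`
  set X : ℝ := max (max H H₀) H₁ with hX
  refine ⟨max 71 (⌈X / Real.log 2⌉₊ + 1), le_trans (by norm_num) (le_max_left _ _), ?_⟩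
  set k : ℕ := max 71 (⌈X / Real.log 2⌉₊ + 1) with hk_def
  have hk71 : 71 ≤ k := le_max_left _ _
  have hk6 : 6 ≤ k := le_trans (by norm_num) hk71
  have hk1 : 1 ≤ k := le_trans (by norm_num) hk71
  have hkX : X < (k : ℝ) * Real.log 2 := by
    have h1 : X / Real.log 2 ≤ ⌈X / Real.log 2⌉₊ := Nat.le_ceil _
    rw [div_le_iff₀ hlog2] at h1
    have h2 : ((⌈X / Real.log 2⌉₊ + 1 : ℕ) : ℝ) ≤ (k : ℝ) := by exact_mod_cast le_max_right _ _
    have h3 := mul_le_mul_of_nonneg_right h2 hlog2.le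
    have h4 : (((⌈X / Real.log 2⌉₊ + 1 : ℕ) : ℝ)) * Real.log 2 = (⌈X / Real.log 2⌉₊ : ℝ) * Real.log 2 + Real.log 2 := by
      push_cast; ring
    linarith
  have hQ := hlogQ hk1
  have hH : H < Cor22.logQForall (QuadWitness.P k) :=
    lt_of_le_of_lt ((le_max_left _ _).trans (le_max_left _ _)) (hkX.trans_le hQ)
  have hH0' : H₀ < Cor22.logQForall (QuadWitness.P k) :=
    lt_of_le_of_lt ((le_max_right _ _).trans (le_max_left _ _)) (hkX.trans_le hQ)
  have hH1' : H₁ ≤ Cor22.logQForall (QuadWitness.P k) := ((le_max_right _ _).trans hkX.le).trans hQ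
  have h49 : (49 : ℝ) < Cor22.logQForall (QuadWitness.P k) := by
    have h71 : (71 : ℝ) ≤ k := by exact_mod_cast hk71
    have h1 := mul_le_mul_of_nonneg_right h71 hlog2.le
    have h2 := Real.log_two_gt_d9
    linarith
  have hhpos : 0 < Cor22.logQForall (QuadWitness.P k) := by linarith
  have hp : ((7 : ℕ) : ℝ) < Real.sqrt (Cor22.logQForall (QuadWitness.P k)) := by
    rw [show ((7 : ℕ) : ℝ) = Real.sqrt (7 ^ 2) by rw [Real.sqrt_sq (by norm_num)]; norm_num]
    exact Real.sqrt_lt_sqrt (by norm_num) (by norm_num; exact h49)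
  obtain ⟨htop, hd⟩ := quadWitness_adjoin_jInv_eq_top ha𝔭 habar ha' h7 h7' hk1
  have hjv : ord QuadWitness.F v₀.1 (Cor22.jInv (QuadWitness.lam k)) ≤ -(2 * k : ℤ) :=
    QuadWitness.ord_jInv_lam_le ha𝔭 h7 hk1
  have hjw : 0 ≤ ord QuadWitness.F w.1 (Cor22.jInv (QuadWitness.lam k)) :=
    (QuadWitness.ord_at_good h7' habar ha' k).2.ge
  have hneg : ord QuadWitness.F v₀.1 (Cor22.jInv (QuadWitness.lam k)) < 0 := by omega
  have hdeg : (QuadWitness.P k).degree ≤ 2 := by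
    change Module.finrank ℚ QuadWitness.F ≤ 2
    rw [QuadWitness.finrank_F]
  -- the window prime
  obtain ⟨l, hlp, hl7, hlp', hP2, hP5, hP6, hlo, hhi⟩ :=
    hH₀ (QuadWitness.P k) (QuadWitness.P_mem_UP ha𝔭 habar ha' h7 h7' hk6) (QuadWitness.P_mem_std hk6) hdeg v₀
      (by norm_num) hneg hH0' hp
  have hl11 : 11 ≤ l := eleven_le_of_prime' hlp hl7 hlp'
  have hl11' : (11 : ℝ) ≤ l := by exact_mod_cast hl11
  have hl𝔭 : ((l : ℕ) : 𝓞 QuadWitness.F) ∉ v₀.1.asIdeal := SplitDepth.natCast_not_mem_of_prime_ne v₀ hlp hlp'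
  have hdR : (Cor22.dmod (QuadWitness.P k) : ℝ) = 2 := by exact_mod_cast hd
  -- the two place sums at `7`
  have hS := mul_log_le_badHeightSum (P := QuadWitness.P k) (l := l) htop v₀.2 hjv hk1 h2𝔭 hl𝔭 hwt1 hn1 hlog7
  have hωA := half_le_goodWeightSum (P := QuadWitness.P k) htop w.2 hjw hwt2 l
  have h7c : ((7 : ℕ) : ℝ) = 7 := by norm_num
  rw [h7c] at hS
  refine ⟨l, hlp, hl7, hlp', hP2, hP5, hP6, ?_, hH, ?_, ?_⟩
  · rw [hdR]; linarith
  · intro p hp7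
    rw [Finset.mem_singleton] at hp7
    subst hp7
    exact lt_of_lt_of_le one_half_pos hωA
  · rw [Finset.sum_singleton]
    -- the error term
    have hE : 2 * Real.log l + 52
        + 20 / 3 * Real.log (((2 ^ 12 * 3 ^ 3 * 5 * Cor22.dmod (QuadWitness.P k) : ℕ) : ℝ) * (l : ℝ))
          * (Nat.primeCounting (2 ^ 12 * 3 ^ 3 * 5 * Cor22.dmod (QuadWitness.P k) * l) : ℝ) ≤
        34 * Cor22.delta 2 * l + 52 := by
      rw [hd]
      have e1 : (2 ^ 12 * 3 ^ 3 * 5 * 2 : ℕ) = 2 ^ 13 * 3 ^ 3 * 5 := by norm_num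
      rw [e1]
      have hc : ((2 ^ 13 * 3 ^ 3 * 5 : ℕ) : ℝ) = Cor22.delta 2 := by simp [Cor22.delta]; norm_num
      rw [← hc]
      exact Cor22Window.errTerm_le (l := l) (by omega)
    have hlC := logCondAvoid_le_logQForall (QuadWitness.P k) {2, l}
    rw [hlD k]
    exact shape_violation_real hdR hl11' hδ ha hc (NFPoint.logDiff_nonneg _) (Cor22.logCondAvoid_nonneg _ _) hlC hhpos hlo hhi
      (hAB k) hB hS (Nat.cast_nonneg k) hωA hE (hH₁ _ hH1')

/-- **NO PRINT-SHAPED CONSTANT REPAIRS THE (U) COMPUTABLE HALF.** For EVERY `a, c ≥ 0` the binder «at every admissible `(λ, l)` (`P ∈ UP`, `l`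
prime `≥ 5`, a core, (P2), (P5), (P6)) the (U)-computable half `Cor22.HullVolumeAtDatum P l δ_{a,c}(P,l)`» with
`δ_{a,c} = ((l+1)/4)·((1 + a·d_mod/l)(log-diff + log-cond^{∤2l}) + c·(2 log l + 52 + (20/3)·log(d*l)·π(d*l)))` is REFUTED (print's `B_III` of
`Conditional.abc_of_S_v3` is `a = 12`, `c = 1`: abc-iut-s2-p5's `not_hvol_v3`). Proof: abc-iut-s2-p1 gen 2's GENERAL-`δ` necessity
`PointDict.pointMixedShare_le_sub_gain_of_hullVolumeAtDatum` at a genuine datum of the admissible `(P_k, l)` of `exists_quadWitness_shapeSlack_lt`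
(abc-iut-L5-t7's `ThetaPartII.stub_thetaData`). READING: on the typed (U) reading no re-derivation of print's explicit constants rescues the hull
estimate; a statement about the cell's typed objects, not about [IUTchIII] Cor. 3.12 or [IUTchIV] Thm. 1.10 as printed; no side taken; typed ≠ proved.
[cite: Mochizuki2012, IUTchIV Thm. 1.10 Steps (v)–(viii) p. 27–31] [cite: Mochizuki2012, IUTchIV Cor. 2.2 (ii) proof p. 44–46]
[claim: Mochizuki2012, status: disputed] -/
theorem not_hullVolume_printShape (a c : ℝ) (ha : 0 ≤ a) (hc : 0 ≤ c) :
    ¬ (∀ P₀ : NFPoint, P₀ ∈ UP → ∀ l : ℕ, l.Prime → 5 ≤ l →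
      Cor22.AdmitsCore P₀ → Cor22.CondP2 P₀ l → Cor22.CondP5 P₀ l → Cor22.CondP6 P₀ l →
        Cor22.HullVolumeAtDatum P₀ l (((l : ℝ) + 1) / 4 *
          ((1 + a * (Cor22.dmod P₀ : ℝ) / l) * (P₀.logDiff + Cor22.logCondAvoid P₀ {2, l})
            + c * (2 * Real.log l + 52
              + 20 / 3 * Real.log (((2 ^ 12 * 3 ^ 3 * 5 * Cor22.dmod P₀ : ℕ) : ℝ) * (l : ℝ))
                * (Nat.primeCounting (2 ^ 12 * 3 ^ 3 * 5 * Cor22.dmod P₀ * l) : ℝ))))) := by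
  intro hvol
  obtain ⟨𝔭, 𝔭', ha𝔭, habar, ha', -, h7, h7'⟩ := QuadWitness.exists_places
  obtain ⟨k, hk6, l, hlp, hl7, -, hP2, hP5, hP6, h4d, -, hω, hlt⟩ :=
    exists_quadWitness_shapeSlack_lt a c ha hc ha𝔭 habar ha' h7 h7' 0
  have hk1 : 1 ≤ k := by omega
  have hP : QuadWitness.P k ∈ UP := QuadWitness.P_mem_UP ha𝔭 habar ha' h7 h7' hk6
  have hcore : Cor22.AdmitsCore (QuadWitness.P k) := QuadWitness.admitsCore_P ha𝔭 h7 hk1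
  have h5 : 5 ≤ l := le_trans (by norm_num) hl7
  obtain ⟨T⟩ := Summit.ABC.ABC.Theorems.ThetaPartII.stub_thetaData (QuadWitness.P k) hP l hlp h5 hcore hP2 hP5 hP6
  have hl0 : 0 < l := by omega
  have h := pointMixedShare_le_sub_gain_of_hullVolumeAtDatum (hvol (QuadWitness.P k) hP l hlp h5 hcore hP2 hP5 hP6) T hl0 h4d
    {7} (fun p hp => by rw [Finset.mem_singleton] at hp; subst hp; norm_num) hω
  exact absurd h (not_le.mpr hlt)

end Conditional

end Summit.ABC.IUTFork

end
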